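import Mathlib
import Literature.Probability.LatticeModels.ScalingLimit3D
import Literature.Probability.LatticeModels.CriticalWickDichotomy
import Literature.Probability.LatticeModels.CriticalScalingDimension
import Literature.Barriers.CriticalPhenomena.ScaleCovarianceNotMoebius
import Summits.CriticalPhenomena.Ising3DConformalLimit.Theses.HyperoctahedralRP

/-!
# Line `circumsphere-one-spin-law` — skeleton for crux `InversionUpgradeNormalised`
(stmt-CriticalPhenomena-1982; route decl
`Summit.CriticalPhenomena.Ising3DConformalLimit.Theses.HyperoctahedralRP.InversionUpgradeNormalised`)

Crux: every normalised (S = 0 off `NonCoincident`), non-degenerate, Euclidean-invariant,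
scale-covariant (weight `Δ`) pointwise scaling limit `S` of `criticalCorr 3` is
`IsInversionCovariant Δ S`.

The lever (d = 3 coincidence): four generic points of `ℝ³` lie on a unique CIRCUMSPHERE, and the
inversion in that sphere fixes the configuration pointwise. Hence at `n = 4` — the first order at
which the crux has content (`n = 0, 2` are automatic, odd orders vanish, Disproof.lean
`inversionUpgradeNormalised_iff_evenFromFour`) — inversion covariance is EMPTY at order zero and at
first order in the normal direction it is the ONE-SPIN LAW: moving one spin radially off the common
sphere, `S₄` decays at the pure conformal rate,
  `d/dt S₄(…, c + eᵗ(xᵢ - c), …)|_{t=0} = -Δ · S₄(x)`  for each `i`.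
By the Euler identity `Σᵢ ((xᵢ - c)·∇ᵢ + Δ) S₄ = 0` (scale covariance about the circumcentre) the
four one-spin laws are forced by four ONE-SIDED inequalities `≤ -Δ S₄` (outward decay at least as
fast as the conformal rate: reflection monotonicity of Messager–Miracle-Solé/Hegerfeldt/Schrader
SHARPENED BY THE CONFORMAL WEIGHT — MMS alone gives `≤ 0`), and by the orbit-tangent lemma
(Robin ∀ i + Euclidean generators + dilation span `so(4,1)` at a non-coplanar configuration) the
one-spin laws integrate to Möbius covariance of `S 4`.

Stubs (4); composition `crux_of_stubs` (explicit hypotheses, sorry-free) and the skeleton theorem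
`InversionUpgradeNormalised_of : …HyperoctahedralRP.InversionUpgradeNormalised := crux_of_stubs stub₁ stub₂ stub₃ stub₄`:
* `stub_fourPointC1`        — regularity: `S 4` is `C¹` on `NonCoincident 3 4` (OS analyticity; shared input).
* `stub_oneSidedOneSpinLaw` — THE ISING INPUT (load-bearing, open): the one-sided one-spin law at
                               every circumsphere configuration, upper-right Dini form (no regularity
                               presupposed). Honours Disproof `¬WithoutIsingLimit` /
                               `not_inversionUpgrade_of_latticeLimit_at`: its model-blind version is
                               false (`narrowFamily` violates the one-spin law, toy jobs j006231/j007208).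
* `stub_oneSpinSqueeze`     — kinematics (model-blind, provable now, L): Euclid + scale + C¹ +
                               one-sided one-spin laws ⇒ inversion covariance of `S 4`
                               (Dini + C¹ ⇒ derivative bound; Euler squeeze ⇒ Robin ∀ i; orbit-tangent
                               lemma ⇒ `K_b S₄ = 0`; integrate along `Möb⁰`, reach `ι` via a reflection).
* `stub_evenPropagation`    — the honest remainder: for the critical limit, inversion covariance of
                               `S 4` propagates to every even order `2m ≥ 6` (no sphere passes through
                               ≥ 5 generic points: the circumsphere lever is an `n = 4` lever; engines:
                               far-field multipole Ward identities `PrimaryAtInfinity.{FirstMultipoleIdentity,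
                               FarFieldClustering, MultipoleToWard, WardToMoebius}`, or the mirror tower of
                               `Ideas/circumsphere-robin-law.md`).
Orders `0`, `2` and odd are discharged inside `crux_of_stubs` from tree theorems
(`HasPointwiseScalingLimit.eq_zero_of_odd`, `ScaleNotMoebius.twoPt_inversion`,
`scalingDimension_mem_Icc_holds` for `0 < Δ`).

Provenance: the idea card `circumsphere-one-spin-law` (ideator 1) was never published (all three
triagers: UNREAD); this skeleton is the planner's reconstruction from the slug, the triage panel's
reading ("move ONE spin off the circumsphere" = the Robin lever of `Ideas/circumsphere-robin-law.md`)
and the panel's sharpenings (one-sided / difference-quotient form; explicit `C¹` hypothesis;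
`n = 4` first). Merge candidate with line `circumsphere-robin-law` under the lead.
-/

noncomputable section

namespace Summit.CriticalPhenomena.Ising3DConformalLimit.Cruxes.InversionUpgradeNormalised.CircumsphereOneSpinLaw

open Literature.Probability.LatticeModels EuclideanGeometry Filter Topology
open Literature.Barriers.CriticalPhenomena

/-! ## The four registered stubs -/

/-- **stub 1 — regularity (shared input).** The four-point function of a normalised,
non-degenerate, Euclidean-invariant, scale-covariant pointwise scaling limit of `criticalCorr 3` is
`C¹` on non-coincident configurations. Intended proof: reflection positivity of `criticalCorr 3`
in the coordinate site-mirrors (FILS 1978; tree `isingMeasure_univ_free_reflectionPositive`) passes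
to the limit; Euclidean invariance + scale covariance give temperedness; OS reconstruction makes
`S 4` real-analytic at non-coincident points (Osterwalder–Schrader 1973/75, Glimm–Jaffe ch. 6, 19).
Size XL (shared with `PrimaryAtInfinity.ExistsRegularLimit`-type inputs and with `FirstLemmaB` of the
robin-law sketch, which carries the same hypothesis). -/
theorem stub_fourPointC1 :
    ∀ (ρ : ℝ → ℝ) (Δ : ℝ) (S : CorrFamily 3), (∀ δ ∈ Set.Ioc (0:ℝ) 1, 0 < ρ δ) →
      HasPointwiseScalingLimit (criticalCorr 3) ρ S →
      (∀ n z, z ∉ NonCoincident 3 n → S n z = 0) → IsNondegenerateTwoPoint S →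
      IsEuclideanInvariant S → IsScaleCovariant Δ S →
      ContDiffOn ℝ 1 (S 4) (NonCoincident 3 4) := by
  sorry

/-- **stub 2 — the one-sided one-spin law for the critical limit (load-bearing, Ising-specific,
open).** At every injective four-point configuration on a sphere (centre `c`, radius `R`), moving ONE
spin radially outward off the sphere, the four-point function decays at least at the conformal rate:
the upper-right Dini derivative of `t ↦ S₄(…, c + eᵗ(xᵢ - c), …)` at `t = 0` is `≤ -Δ · S₄(x)`,
for each `i`. (Messager–Miracle-Solé / Hegerfeldt reflection monotonicity in the tangent plane at
`xᵢ` — the other three spins lie on the centre's side — gives `≤ 0` in the limit; the conformal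
weight `Δ` is the whole content. Model-blind it is FALSE: `ScaleNotMoebius.narrowFamily` violates
it, as it must by `not_inversionUpgrade_of_latticeLimit_at`; so a proof spends `criticalCorr 3`
structure — random-current form of `U₄`, RP at `n = 6`, lattice Ward/switching identities.)
Stated in Dini form so that no regularity is presupposed; with `stub_fourPointC1` it is the
derivative inequality `rᵢ ∂_{rᵢ} S₄ ≤ -Δ S₄`, and by the Euler identity it is EQUIVALENT to the
two-sided law given the crux (zero slack: any coupling proof must be asymptotically tight). -/
theorem stub_oneSidedOneSpinLaw :
    ∀ (ρ : ℝ → ℝ) (Δ : ℝ) (S : CorrFamily 3), (∀ δ ∈ Set.Ioc (0:ℝ) 1, 0 < ρ δ) →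
      HasPointwiseScalingLimit (criticalCorr 3) ρ S →
      (∀ n z, z ∉ NonCoincident 3 n → S n z = 0) → IsNondegenerateTwoPoint S →
      IsEuclideanInvariant S → IsScaleCovariant Δ S →
      ∀ (x : Fin 4 → EuclideanSpace ℝ (Fin 3)) (c : EuclideanSpace ℝ (Fin 3)) (R : ℝ), 0 < R →
        Function.Injective x → (∀ i, dist (x i) c = R) →
        ∀ (i : Fin 4) (ε : ℝ), 0 < ε →
          ∀ᶠ t in 𝓝[>] (0:ℝ),
            (S 4 (Function.update x i (c + Real.exp t • (x i - c))) - S 4 x) / t ≤ -Δ * S 4 x + ε := by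
  sorry

/-- **stub 3 — the one-spin squeeze (kinematics; model-blind; provable now, size L).** For a
Euclidean-invariant, scale-covariant (`Δ > 0`) family whose four-point function is `C¹` on and
vanishes off `NonCoincident 3 4`, the one-sided one-spin laws at every circumsphere configuration
imply inversion covariance of `S 4`. Proof route: (i) `C¹` turns the Dini bound into
`∂ₜ S₄ ≤ -Δ S₄` along each radial one-spin move; (ii) scale covariance about `c` (scale about `0`
conjugated by the translation) differentiates to the Euler identity `Σᵢ ∂ₜᵢ S₄ = -4Δ S₄`, so all
four inequalities are equalities (Robin ∀ i); (iii) on the sphere `‖xᵢ - c‖ = R` the special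
conformal generator centred at `c` is `K_b^{(c)} = 2 Σᵢ (b·(xᵢ - c))·((xᵢ - c)·∇ᵢ + Δ) - R²(b·P)`,
so Robin ∀ i + translations annihilate every `K_b` at non-coplanar configurations, hence (by
continuity of the `C¹` data) on all of `NonCoincident 3 4`; (iv) integrate the first-order
identities along the flows of `Möb⁰(3) ≅ SO⁺(4,1)` on the connected set `{g | g·x finite}` and reach
the unit inversion as `(ι ∘ θ) ∘ θ` with `θ ∈ O(3)` a reflection (rotation invariance includes
reflections); non-injective `x` have both sides `0`. This is the `→` half of `FirstLemmaB`
(`Cruxes/…/Ideator3Sketch.lean`) with the one-sided sharpening asked for by TRIAGE-r1-3. -/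
theorem stub_oneSpinSqueeze :
    ∀ (Δ : ℝ) (S : CorrFamily 3), 0 < Δ → IsEuclideanInvariant S → IsScaleCovariant Δ S →
      ContDiffOn ℝ 1 (S 4) (NonCoincident 3 4) →
      (∀ z, z ∉ NonCoincident 3 4 → S 4 z = 0) →
      (∀ (x : Fin 4 → EuclideanSpace ℝ (Fin 3)) (c : EuclideanSpace ℝ (Fin 3)) (R : ℝ), 0 < R →
        Function.Injective x → (∀ i, dist (x i) c = R) →
        ∀ (i : Fin 4) (ε : ℝ), 0 < ε →
          ∀ᶠ t in 𝓝[>] (0:ℝ),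
            (S 4 (Function.update x i (c + Real.exp t • (x i - c))) - S 4 x) / t ≤ -Δ * S 4 x + ε) →
      ∀ (x : Fin 4 → EuclideanSpace ℝ (Fin 3)), (∀ i, x i ≠ 0) →
        S 4 (fun i => inversion 0 1 (x i)) = (∏ i, ‖x i‖ ^ (2 * Δ)) * S 4 x := by
  sorry

/-- **stub 4 — even-order propagation (the remainder the circumsphere lever does not reduce;
open).** For a normalised, non-degenerate, Euclidean-invariant, scale-covariant pointwise limit of
`criticalCorr 3` whose FOUR-point function is inversion covariant, every even order `2m ≥ 6` is
inversion covariant. Why a separate input is needed: no sphere passes through five generic points,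
and the cospherical one-spin laws do NOT propagate model-blindly at `n ≥ 5` (decoy
`F_n · (1 + Q_n²)`, `F_n` Möbius covariant, `Q_n` a similarity-invariant non-Möbius-invariant
real-analytic function vanishing on the cospherical locus). Engines: the far-field multipole Ward
identities of route `PrimaryAtInfinity` (`FirstMultipoleIdentity ∧ FarFieldClustering ∧
MultipoleToWard ∧ WardToMoebius` give the weak special-conformal Ward identity at every order; the
two-point law `S₂ = c‖a-b‖^{-2Δ}`, `c > 0`, needed there follows from Euclid + scale +
non-degeneracy), or the mirror tower of `Ideas/circumsphere-robin-law.md`; the hypothesis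
"`S 4` covariant" fixes the `σ × σ` data such engines start from. Why it might fail: a
`ℤ₂`-even scale-covariant non-conformal sector invisible at `n = 4` (independent sum `ψ ⊕ O` with
`u₄^O ≡ 0`, `u₆^O` non-conformal) — excluded for Lee–Yang/Griffiths families only conjecturally. -/
theorem stub_evenPropagation :
    ∀ (ρ : ℝ → ℝ) (Δ : ℝ) (S : CorrFamily 3), (∀ δ ∈ Set.Ioc (0:ℝ) 1, 0 < ρ δ) →
      HasPointwiseScalingLimit (criticalCorr 3) ρ S →
      (∀ n z, z ∉ NonCoincident 3 n → S n z = 0) → IsNondegenerateTwoPoint S →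
      IsEuclideanInvariant S → IsScaleCovariant Δ S →
      (∀ (x : Fin 4 → EuclideanSpace ℝ (Fin 3)), (∀ i, x i ≠ 0) →
        S 4 (fun i => inversion 0 1 (x i)) = (∏ i, ‖x i‖ ^ (2 * Δ)) * S 4 x) →
      ∀ (m : ℕ), 3 ≤ m → ∀ (x : Fin (2 * m) → EuclideanSpace ℝ (Fin 3)), (∀ i, x i ≠ 0) →
        S (2 * m) (fun i => inversion 0 1 (x i)) = (∏ i, ‖x i‖ ^ (2 * Δ)) * S (2 * m) x := by
  sorry

/-! ## Sorry-free glue: orders `0`, `2` and odd (tree theorems) -/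

/-- Odd orders of a normalised pointwise limit of `criticalCorr 3` vanish everywhere
(`m*(β_c) = 0`: tree theorem `HasPointwiseScalingLimit.eq_zero_of_odd` on `NonCoincident`,
normalisation off it). [cite: AizenmanDuminilCopinSidoraviciusCMP2015, Thm. 1.2] -/
theorem eq_zero_of_odd_everywhere {ρ : ℝ → ℝ} {S : CorrFamily 3}
    (hlim : HasPointwiseScalingLimit (criticalCorr 3) ρ S)
    (hnorm : ∀ n z, z ∉ NonCoincident 3 n → S n z = 0) {n : ℕ} (hn : Odd n)
    (x : Fin n → EuclideanSpace ℝ (Fin 3)) : S n x = 0 := by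
  by_cases hx : x ∈ NonCoincident 3 n
  · exact hlim.eq_zero_of_odd le_rfl hn hx
  · exact hnorm n x hx

/-- Two-point structure of a Euclidean-invariant, scale-covariant family: for `a ≠ b`,
`S₂(a,b) = ‖a - b‖^{-2Δ} · S₂(0,e₁)` (translate, reflect onto the axis, scale; as in
`Cruxes/…/Ideator2Sketch.lean`, `two_point_eq`). [folklore] -/
theorem two_point_eq {Δ : ℝ} {S : CorrFamily 3} (heuc : IsEuclideanInvariant S)
    (hsc : IsScaleCovariant Δ S) {a b : EuclideanSpace ℝ (Fin 3)} (hab : a ≠ b) :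
    S 2 ![a, b] = ‖a - b‖ ^ (-(2 * Δ)) * S 2 ![0, EuclideanSpace.single 0 1] := by
  set e : EuclideanSpace ℝ (Fin 3) := EuclideanSpace.single 0 1 with he
  have hne : ‖e‖ = 1 := by simp [he]
  set r : ℝ := ‖b - a‖ with hr
  have hr0 : 0 < r := norm_pos_iff.mpr (sub_ne_zero.mpr (Ne.symm hab))
  -- translate by `-a`
  have h1 : S 2 ![a, b] = S 2 ![0, b - a] := by
    have h := heuc.1 2 (-a) ![a, b]
    rw [← h]
    congr 1
    funext i
    fin_cases i <;> simp [sub_eq_add_neg]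
  -- reflect `b - a` onto `r • e`
  have hnorm_eq : ‖b - a‖ = ‖r • e‖ := by
    rw [norm_smul, hne, mul_one, Real.norm_eq_abs, abs_of_pos hr0]
  have hRv : Submodule.reflection (ℝ ∙ ((b - a) - r • e))ᗮ (b - a) = r • e :=
    Submodule.reflection_sub hnorm_eq
  have h2 : S 2 ![0, b - a] = S 2 ![0, r • e] := by
    have h := heuc.2 2 (Submodule.reflection (ℝ ∙ ((b - a) - r • e))ᗮ) ![0, b - a]
    rw [← h]
    congr 1
    funext i
    fin_cases i <;> simp [hRv]
  -- scale by `r`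
  have h3 : S 2 ![0, r • e] = r ^ (-(2 * Δ)) * S 2 ![0, e] := by
    have h := hsc 2 r hr0 ![0, e]
    have hfun : (fun i => r • (![0, e] : Fin 2 → EuclideanSpace ℝ (Fin 3)) i) = ![0, r • e] := by
      funext i
      fin_cases i <;> simp
    have hexp : (-((2 : ℕ) : ℝ) * Δ) = -(2 * Δ) := by push_cast; ring
    rw [hfun, hexp] at h
    exact h
  rw [h1, h2, h3, hr, norm_sub_rev]

/-- The two-point inversion law (model-blind, order `2` of the crux): for distinct non-zero
`p, q`, `S₂(ιp, ιq) = ‖p‖^{2Δ}‖q‖^{2Δ} S₂(p, q)` (barrier lemma `ScaleNotMoebius.twoPt_inversion`,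
Mathlib `dist_inversion_inversion`). [folklore] -/
theorem two_point_inversion {Δ : ℝ} {S : CorrFamily 3} (heuc : IsEuclideanInvariant S)
    (hsc : IsScaleCovariant Δ S) {p q : EuclideanSpace ℝ (Fin 3)} (hpq : p ≠ q) (hp : p ≠ 0)
    (hq : q ≠ 0) :
    S 2 ![inversion 0 1 p, inversion 0 1 q] = ‖p‖ ^ (2 * Δ) * ‖q‖ ^ (2 * Δ) * S 2 ![p, q] := by
  have hinj := inversion_injective (0 : EuclideanSpace ℝ (Fin 3)) one_ne_zero
  have hpq' : inversion 0 1 p ≠ inversion 0 1 q := fun h => hpq (hinj h)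
  rw [two_point_eq heuc hsc hpq', two_point_eq heuc hsc hpq]
  have key := ScaleNotMoebius.twoPt_inversion Δ hp hq
  simp only [ScaleNotMoebius.twoPt] at key
  rw [key]
  ring

/-! ## Composition: the four stubs imply the crux, by name -/

/-- Local alias of the crux, used ONLY as the conclusion of the pure-logic composition lemma
`crux_of_stubs` (so that the audit's skeleton theorem is the hypothesis-free
`InversionUpgradeNormalised_of` below, which concludes the route decl by its own name). -/
abbrev Crux : Prop :=
  Summit.CriticalPhenomena.Ising3DConformalLimit.Theses.HyperoctahedralRP.InversionUpgradeNormalised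

/-- **Pure-logic composition (sorry-free, axioms ⊆ {propext, Classical.choice, Quot.sound}).**
`stub_fourPointC1-stmt → stub_oneSidedOneSpinLaw-stmt → stub_oneSpinSqueeze-stmt →
stub_evenPropagation-stmt → crux`: `0 < Δ` from `scalingDimension_mem_Icc_holds`; order `4` from the
one-spin law squeezed (stubs 1–3); even orders `≥ 6` from stub 4; order `0` trivially, order `2` by
`two_point_inversion`, odd orders vanish (`eq_zero_of_odd_everywhere`); non-injective configurations by
the normalisation. -/
theorem crux_of_stubs
    (h_reg : ∀ (ρ : ℝ → ℝ) (Δ : ℝ) (S : CorrFamily 3), (∀ δ ∈ Set.Ioc (0:ℝ) 1, 0 < ρ δ) →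
      HasPointwiseScalingLimit (criticalCorr 3) ρ S →
      (∀ n z, z ∉ NonCoincident 3 n → S n z = 0) → IsNondegenerateTwoPoint S →
      IsEuclideanInvariant S → IsScaleCovariant Δ S →
      ContDiffOn ℝ 1 (S 4) (NonCoincident 3 4))
    (h_law : ∀ (ρ : ℝ → ℝ) (Δ : ℝ) (S : CorrFamily 3), (∀ δ ∈ Set.Ioc (0:ℝ) 1, 0 < ρ δ) →
      HasPointwiseScalingLimit (criticalCorr 3) ρ S →
      (∀ n z, z ∉ NonCoincident 3 n → S n z = 0) → IsNondegenerateTwoPoint S →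
      IsEuclideanInvariant S → IsScaleCovariant Δ S →
      ∀ (x : Fin 4 → EuclideanSpace ℝ (Fin 3)) (c : EuclideanSpace ℝ (Fin 3)) (R : ℝ), 0 < R →
        Function.Injective x → (∀ i, dist (x i) c = R) →
        ∀ (i : Fin 4) (ε : ℝ), 0 < ε →
          ∀ᶠ t in 𝓝[>] (0:ℝ),
            (S 4 (Function.update x i (c + Real.exp t • (x i - c))) - S 4 x) / t ≤ -Δ * S 4 x + ε)
    (h_sq : ∀ (Δ : ℝ) (S : CorrFamily 3), 0 < Δ → IsEuclideanInvariant S → IsScaleCovariant Δ S →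
      ContDiffOn ℝ 1 (S 4) (NonCoincident 3 4) →
      (∀ z, z ∉ NonCoincident 3 4 → S 4 z = 0) →
      (∀ (x : Fin 4 → EuclideanSpace ℝ (Fin 3)) (c : EuclideanSpace ℝ (Fin 3)) (R : ℝ), 0 < R →
        Function.Injective x → (∀ i, dist (x i) c = R) →
        ∀ (i : Fin 4) (ε : ℝ), 0 < ε →
          ∀ᶠ t in 𝓝[>] (0:ℝ),
            (S 4 (Function.update x i (c + Real.exp t • (x i - c))) - S 4 x) / t ≤ -Δ * S 4 x + ε) →
      ∀ (x : Fin 4 → EuclideanSpace ℝ (Fin 3)), (∀ i, x i ≠ 0) →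
        S 4 (fun i => inversion 0 1 (x i)) = (∏ i, ‖x i‖ ^ (2 * Δ)) * S 4 x)
    (h_prop : ∀ (ρ : ℝ → ℝ) (Δ : ℝ) (S : CorrFamily 3), (∀ δ ∈ Set.Ioc (0:ℝ) 1, 0 < ρ δ) →
      HasPointwiseScalingLimit (criticalCorr 3) ρ S →
      (∀ n z, z ∉ NonCoincident 3 n → S n z = 0) → IsNondegenerateTwoPoint S →
      IsEuclideanInvariant S → IsScaleCovariant Δ S →
      (∀ (x : Fin 4 → EuclideanSpace ℝ (Fin 3)), (∀ i, x i ≠ 0) →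
        S 4 (fun i => inversion 0 1 (x i)) = (∏ i, ‖x i‖ ^ (2 * Δ)) * S 4 x) →
      ∀ (m : ℕ), 3 ≤ m → ∀ (x : Fin (2 * m) → EuclideanSpace ℝ (Fin 3)), (∀ i, x i ≠ 0) →
        S (2 * m) (fun i => inversion 0 1 (x i)) = (∏ i, ‖x i‖ ^ (2 * Δ)) * S (2 * m) x) :
    Crux := by
  intro ρ Δ S hρ hlim hnorm hnd heuc hsc
  have hΔ : Δ ∈ Set.Icc (1 / 2 : ℝ) 1 := scalingDimension_mem_Icc_holds ρ Δ S hlim hsc hnd hρ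
  have hΔpos : 0 < Δ := lt_of_lt_of_le one_half_pos hΔ.1
  -- order 4: the one-spin law, squeezed
  have h4 : ∀ (x : Fin 4 → EuclideanSpace ℝ (Fin 3)), (∀ i, x i ≠ 0) →
      S 4 (fun i => inversion 0 1 (x i)) = (∏ i, ‖x i‖ ^ (2 * Δ)) * S 4 x :=
    h_sq Δ S hΔpos heuc hsc (h_reg ρ Δ S hρ hlim hnorm hnd heuc hsc) (hnorm 4)
      (h_law ρ Δ S hρ hlim hnorm hnd heuc hsc)
  -- even orders ≥ 6
  have h6 := h_prop ρ Δ S hρ hlim hnorm hnd heuc hsc h4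
  set ι : EuclideanSpace ℝ (Fin 3) → EuclideanSpace ℝ (Fin 3) := inversion 0 1 with hι
  have hinj : Function.Injective ι := inversion_injective (0 : EuclideanSpace ℝ (Fin 3)) one_ne_zero
  intro n x hx0
  obtain ⟨k, rfl | rfl⟩ := Nat.even_or_odd' n
  · -- even order `n = 2k`
    rcases k with _ | _ | _ | k
    · -- `n = 0`: both configurations are the empty one
      have hi : ∀ i : Fin (2 * 0), False := fun i => by have := i.isLt; omega
      have hfun : (fun i => ι (x i)) = x := funext fun i => (hi i).elim
      rw [hfun, Finset.prod_eq_one (fun i _ => (hi i).elim), one_mul]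
    · -- `n = 2`
      by_cases hx : Function.Injective x
      · have hx01 : x 0 ≠ x 1 := fun h => absurd (hx h) (by decide)
        have hxv : x = ![x 0, x 1] := by funext i; fin_cases i <;> rfl
        have hιv : (fun i => ι (x i)) = ![ι (x 0), ι (x 1)] := by funext i; fin_cases i <;> rfl
        rw [hιv, hxv]
        simp only [Matrix.cons_val_zero, Matrix.cons_val_one]
        rw [Fin.prod_univ_two]
        simp only [Matrix.cons_val_zero, Matrix.cons_val_one]
        exact two_point_inversion heuc hsc hx01 (hx0 0) (hx0 1)
      · have hιx : ¬ Function.Injective (fun i => ι (x i)) :=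
          fun h => hx (hinj.of_comp_iff x |>.mp h)
        rw [hnorm _ _ hιx, hnorm _ _ hx, mul_zero]
    · -- `n = 4`
      exact h4 x hx0
    · -- `n = 2(k+3) ≥ 6`
      exact h6 (k + 1 + 1 + 1) (by omega) x hx0
  · -- odd order: both sides vanish
    rw [eq_zero_of_odd_everywhere hlim hnorm ⟨k, rfl⟩, eq_zero_of_odd_everywhere hlim hnorm ⟨k, rfl⟩,
      mul_zero]

/-- **The skeleton theorem: the line closes the crux BY NAME.** Hypothesis-free; its only
non-whitelisted axiom is the `sorryAx` of the four declared stubs, fed to `crux_of_stubs`. When the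
stubs are proved this declaration is a proof of item stmt-CriticalPhenomena-1982. -/
theorem InversionUpgradeNormalised_of :
    Summit.CriticalPhenomena.Ising3DConformalLimit.Theses.HyperoctahedralRP.InversionUpgradeNormalised :=
  crux_of_stubs stub_fourPointC1 stub_oneSidedOneSpinLaw stub_oneSpinSqueeze stub_evenPropagation

/-! ## Disproof used (standing disprover, Disproof.lean v4, evidence notes of stmt-1982)

* `¬WithoutIsingLimit` / barrier `not_inversionUpgrade_of_latticeLimit_at` (landed p68577): the
  lattice clause (H2) is load-bearing at every `Δ > 0` and not weakenable to generic lattice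
  provenance — honoured at `stub_oneSidedOneSpinLaw` (the only stub with the `criticalCorr 3`
  hypothesis doing work; its model-blind version is refuted by `narrowFamily`, which violates the
  one-spin law) and at `stub_evenPropagation`.
* `¬WithoutNormalisation` (H3): both sides of every stub conclusion vanish off `NonCoincident`
  (inversion is injective off `0`); the normalisation is threaded through `stub_oneSpinSqueeze`.
* `¬WithoutScaleCovariance` (H6): scale covariance is used twice — Euler identity in the squeeze,
  `0 < Δ` via `scalingDimension_mem_Icc_holds`.
* crux ⇔ even `n ≥ 4` (`inversionUpgradeNormalised_iff_evenFromFour`): the composition discharges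
  `n = 0, 2` and odd `n` exactly as there; refuted strengthenings (origin guard, exponent) untouched:
  every stub keeps `∀ i, x i ≠ 0` and the weight `∏ ‖x i‖^{2Δ}`.
-/

/-- Anchor: the barrier theorem this line answers to (model-blind lattice provenance is empty). -/
example {Δ : ℝ} (hΔ : 0 < Δ) :
    ¬ ∀ (G : LatticeCorrFamily 3) (ρ : ℝ → ℝ) (S : CorrFamily 3), (∀ δ ∈ Set.Ioc (0:ℝ) 1, 0 < ρ δ) →
      HasPointwiseScalingLimit G ρ S →
      (∀ n z, z ∉ NonCoincident 3 n → S n z = 0) → IsNondegenerateTwoPoint S →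
      IsEuclideanInvariant S → IsScaleCovariant Δ S → IsInversionCovariant Δ S :=
  not_inversionUpgrade_of_latticeLimit_at hΔ

end Summit.CriticalPhenomena.Ising3DConformalLimit.Cruxes.InversionUpgradeNormalised.CircumsphereOneSpinLaw

end
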